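import Mathlib
import Summits.Ventures.PercRepro2.CoinKSureAD
import Summits.Ventures.PercRepro2.CoinChainXASigns

/-!
# (XA′) from the COMPLEMENT bound: FKG of a reference law minus the killed part
(blind cell PercRepro2, night-2 g26; proofs/NIGHT2-DARC.md §67.12)

Every chain law `L ∈ {R_ρ = ν·chainMix ρ c d, G_ρ = ν·chainMix ρ c d'}` is log-supermodular, so
FKG gives `l1 l2 ≤ l0 l12` (`chain_fkg_R`, `chain_fkg_G`; `l12 = ∑ L (x y)`).  Writing the gate
functional as the reference law's functional minus the killed part `L − G¹`:
`U001 = (a0/l0)²·∑ L (l0 x − l1)(l0 y − l2) + (a0 l1 − a1 l0)(a0 l2 − a2 l0)/l0 − D_L`,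
`D_L = ∑ (L − G¹)(a0 x − a1)(a0 y − a2)`, so (XA′) holds whenever
`l0·Cross ≤ a0·[(a0 l1 − a1 l0)(a0 l2 − a2 l0) − l0·D_L]` (`chain_XA'_of_complement`; at `L = G¹`
this is the FKG-crude bound, at `L = R⁰` the pure complement bound `Cross ≤ −a0·D_{R⁰}`).
Census (cover6.py, 7,080 pairs): the complement bounds at the four laws cover 98.1–100 %, and
together with the cakes of CoinChainXACake 100 % (no exception left in the census — not a proof).
-/

namespace Summit.Ventures.PercRepro2.Coin

open Classical

section ComplementAlg

variable {R : Type*} [Field R] [LinearOrder R] [IsStrictOrderedRing R]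

/-- The algebra: with `C := l0 (l0 l12 − l1 l2) ≥ 0` (FKG of the reference law) and
`l0·U001 = (a0²/l0)·C + (a0 l1 − a1 l0)(a0 l2 − a2 l0) − l0·D`. -/
theorem xa_complement_alg (a0 a1 a2 l0 l1 l2 l12 g0 g1 g2 g12 Cr : R) (hl0 : 0 < l0) (ha0 : 0 ≤ a0)
    (hC : l1 * l2 ≤ l0 * l12)
    (hcomp : l0 * Cr ≤ a0 * ((a0 * l1 - a1 * l0) * (a0 * l2 - a2 * l0)
      - l0 * (a0 * a0 * (l12 - g12) - a0 * a2 * (l1 - g1) - a0 * a1 * (l2 - g2) + a1 * a2 * (l0 - g0)))) :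
    Cr ≤ a0 * (a0 * a0 * g12 - a0 * a2 * g1 - a0 * a1 * g2 + a1 * a2 * g0) := by
  have hid : l0 * (a0 * (a0 * a0 * g12 - a0 * a2 * g1 - a0 * a1 * g2 + a1 * a2 * g0)) =
      a0 * (a0 * a0 * (l0 * l12 - l1 * l2) + (a0 * l1 - a1 * l0) * (a0 * l2 - a2 * l0)
        - l0 * (a0 * a0 * (l12 - g12) - a0 * a2 * (l1 - g1) - a0 * a1 * (l2 - g2) + a1 * a2 * (l0 - g0))) := by
    ring
  have hC' : 0 ≤ a0 * (a0 * a0 * (l0 * l12 - l1 * l2)) :=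
    mul_nonneg ha0 (mul_nonneg (mul_nonneg ha0 ha0) (by linarith))
  have h2 : l0 * Cr ≤ l0 * (a0 * (a0 * a0 * g12 - a0 * a2 * g1 - a0 * a1 * g2 + a1 * a2 * g0)) := by
    rw [hid]; nlinarith [hcomp, hC']
  exact le_of_mul_le_mul_left h2 hl0

end ComplementAlg

section ComplementChain

variable {V : Type*} [DecidableEq V] {R : Type*} [Field R] [LinearOrder R] [IsStrictOrderedRing R]

/-- **FKG OF THE COIN LAW `R_ρ`**: `l1 l2 ≤ l0 l12`. -/
theorem chain_fkg_R (U ent ent' : Finset V) (ν c d : Finset V → R)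
    (ρ : R) (hρ0 : 0 ≤ ρ) (hρ1 : ρ ≤ 1) (hν0 : ∀ W, 0 ≤ ν W)
    (hν : ∀ s ⊆ U, ∀ t ⊆ U, ν s * ν t ≤ ν (s ∩ t) * ν (s ∪ t))
    (hc0 : ∀ W, 0 ≤ c W) (hd0 : ∀ W, 0 ≤ d W) (hdc : ∀ W, d W ≤ c W)
    (hcc : ∀ s t, c s * c t ≤ c (s ∩ t) * c (s ∪ t))
    (hdd : ∀ s t, d s * d t ≤ d (s ∩ t) * d (s ∪ t))
    (hcd : ∀ s t, c s * d t ≤ c (s ∩ t) * d (s ∪ t))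
    (hratio : ∀ s t, s ⊆ t → d s * c t ≤ c s * d t)
    (x y : Finset V → R) (hx0 : ∀ W, 0 ≤ x W) (hy0 : ∀ W, 0 ≤ y W)
    (hxm : ∀ s t, x s ≤ x (s ∪ t)) (hym : ∀ s t, y s ≤ y (s ∪ t)) :
    (∑ W ∈ U.powerset, ν W * chainMix ent ent' ρ c d W * x W) * (∑ W ∈ U.powerset, ν W * chainMix ent ent' ρ c d W * y W) ≤ (∑ W ∈ U.powerset, ν W * chainMix ent ent' ρ c d W) * (∑ W ∈ U.powerset, ν W * chainMix ent ent' ρ c d W * (x W * y W)):= by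
  have hmρ : ∀ W, 0 ≤ chainMix ent ent' ρ c d W := chainMix_nonneg ent ent' hρ0 hρ1 hc0 hd0
  have hL0 : ∀ W, 0 ≤ ν W * chainMix ent ent' ρ c d W := fun W => mul_nonneg (hν0 W) (hmρ W)
  have hmix := mixture_lsm ent ent' ρ hρ0 hρ1 c d hc0 hd0 hdc hcc hdd hcd hratio
  refine ad_pointwise U _ _ _ _ (fun W => mul_nonneg (hL0 W) (hx0 W))
    (fun W => mul_nonneg (hL0 W) (hy0 W)) hL0
    (fun W => mul_nonneg (hL0 W) (mul_nonneg (hx0 W) (hy0 W))) ?_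
  intro s hs t ht
  have hxs : x s ≤ x (s ∪ t) := hxm s t
  have hyt : y t ≤ y (s ∪ t) := by rw [Finset.union_comm]; exact hym t s
  have hlsm : ν s * chainMix ent ent' ρ c d s * (ν t * chainMix ent ent' ρ c d t) ≤
      ν (s ∩ t) * chainMix ent ent' ρ c d (s ∩ t) * (ν (s ∪ t) * chainMix ent ent' ρ c d (s ∪ t)) := by
    calc ν s * chainMix ent ent' ρ c d s * (ν t * chainMix ent ent' ρ c d t)
        = (ν s * ν t) * (chainMix ent ent' ρ c d s * chainMix ent ent' ρ c d t) := by ring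
      _ ≤ (ν (s ∩ t) * ν (s ∪ t)) *
            (chainMix ent ent' ρ c d (s ∩ t) * chainMix ent ent' ρ c d (s ∪ t)) :=
          mul_le_mul (hν s hs t ht) (hmix s t) (mul_nonneg (hmρ _) (hmρ _))
            (mul_nonneg (hν0 _) (hν0 _))
      _ = _ := by ring
  calc ν s * chainMix ent ent' ρ c d s * x s * (ν t * chainMix ent ent' ρ c d t * y t)
      = (ν s * chainMix ent ent' ρ c d s * (ν t * chainMix ent ent' ρ c d t)) * (x s * y t) := by
        ring
    _ ≤ (ν (s ∩ t) * chainMix ent ent' ρ c d (s ∩ t) * (ν (s ∪ t) * chainMix ent ent' ρ c d (s ∪ t))) *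
          (x (s ∪ t) * y (s ∪ t)) :=
        mul_le_mul hlsm (mul_le_mul hxs hyt (hy0 t) (hx0 _)) (mul_nonneg (hx0 s) (hy0 t))
          (mul_nonneg (mul_nonneg (hν0 _) (hmρ _)) (mul_nonneg (hν0 _) (hmρ _)))
    _ = _ := by ring

/-- **FKG OF THE GATE LAW `G_ρ`**: `l1 l2 ≤ l0 l12`. -/
theorem chain_fkg_G (U ent ent' : Finset V) (ν c d' : Finset V → R)
    (ρ : R) (hρ0 : 0 ≤ ρ) (hρ1 : ρ ≤ 1) (hν0 : ∀ W, 0 ≤ ν W)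
    (hν : ∀ s ⊆ U, ∀ t ⊆ U, ν s * ν t ≤ ν (s ∩ t) * ν (s ∪ t))
    (hc0 : ∀ W, 0 ≤ c W) (hd'0 : ∀ W, 0 ≤ d' W) (hd'c : ∀ W, d' W ≤ c W)
    (hcc : ∀ s t, c s * c t ≤ c (s ∩ t) * c (s ∪ t))
    (hd'd' : ∀ s t, d' s * d' t ≤ d' (s ∩ t) * d' (s ∪ t))
    (hcd' : ∀ s t, c s * d' t ≤ c (s ∩ t) * d' (s ∪ t))
    (hratio' : ∀ s t, s ⊆ t → d' s * c t ≤ c s * d' t)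
    (x y : Finset V → R) (hx0 : ∀ W, 0 ≤ x W) (hy0 : ∀ W, 0 ≤ y W)
    (hxm : ∀ s t, x s ≤ x (s ∪ t)) (hym : ∀ s t, y s ≤ y (s ∪ t)) :
    (∑ W ∈ U.powerset, ν W * chainMix ent ent' ρ c d' W * x W) * (∑ W ∈ U.powerset, ν W * chainMix ent ent' ρ c d' W * y W) ≤ (∑ W ∈ U.powerset, ν W * chainMix ent ent' ρ c d' W) * (∑ W ∈ U.powerset, ν W * chainMix ent ent' ρ c d' W * (x W * y W)):= by
  have hmρ : ∀ W, 0 ≤ chainMix ent ent' ρ c d' W := chainMix_nonneg ent ent' hρ0 hρ1 hc0 hd'0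
  have hL0 : ∀ W, 0 ≤ ν W * chainMix ent ent' ρ c d' W := fun W => mul_nonneg (hν0 W) (hmρ W)
  have hmix := mixture_lsm ent ent' ρ hρ0 hρ1 c d' hc0 hd'0 hd'c hcc hd'd' hcd' hratio'
  refine ad_pointwise U _ _ _ _ (fun W => mul_nonneg (hL0 W) (hx0 W))
    (fun W => mul_nonneg (hL0 W) (hy0 W)) hL0
    (fun W => mul_nonneg (hL0 W) (mul_nonneg (hx0 W) (hy0 W))) ?_
  intro s hs t ht
  have hxs : x s ≤ x (s ∪ t) := hxm s t
  have hyt : y t ≤ y (s ∪ t) := by rw [Finset.union_comm]; exact hym t s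
  have hlsm : ν s * chainMix ent ent' ρ c d' s * (ν t * chainMix ent ent' ρ c d' t) ≤
      ν (s ∩ t) * chainMix ent ent' ρ c d' (s ∩ t) * (ν (s ∪ t) * chainMix ent ent' ρ c d' (s ∪ t)) := by
    calc ν s * chainMix ent ent' ρ c d' s * (ν t * chainMix ent ent' ρ c d' t)
        = (ν s * ν t) * (chainMix ent ent' ρ c d' s * chainMix ent ent' ρ c d' t) := by ring
      _ ≤ (ν (s ∩ t) * ν (s ∪ t)) *
            (chainMix ent ent' ρ c d' (s ∩ t) * chainMix ent ent' ρ c d' (s ∪ t)) :=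
          mul_le_mul (hν s hs t ht) (hmix s t) (mul_nonneg (hmρ _) (hmρ _))
            (mul_nonneg (hν0 _) (hν0 _))
      _ = _ := by ring
  calc ν s * chainMix ent ent' ρ c d' s * x s * (ν t * chainMix ent ent' ρ c d' t * y t)
      = (ν s * chainMix ent ent' ρ c d' s * (ν t * chainMix ent ent' ρ c d' t)) * (x s * y t) := by
        ring
    _ ≤ (ν (s ∩ t) * chainMix ent ent' ρ c d' (s ∩ t) * (ν (s ∪ t) * chainMix ent ent' ρ c d' (s ∪ t))) *
          (x (s ∪ t) * y (s ∪ t)) :=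
        mul_le_mul hlsm (mul_le_mul hxs hyt (hy0 t) (hx0 _)) (mul_nonneg (hx0 s) (hy0 t))
          (mul_nonneg (mul_nonneg (hν0 _) (hmρ _)) (mul_nonneg (hν0 _) (hmρ _)))
    _ = _ := by ring

/-- **(XA′) FROM THE COMPLEMENT BOUND AT A REFERENCE LAW** with moments `(l0, l1, l2, l12)`
(`hC` = its FKG inequality, `hcomp` = the cleared moment condition). -/
theorem chain_XA'_of_complement (U ent ent' : Finset V) (ν c d d' : Finset V → R)
    (hν0 : ∀ W, 0 ≤ ν W) (hc0 : ∀ W, 0 ≤ c W) (hd0 : ∀ W, 0 ≤ d W)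
    (x y : Finset V → R)
    (l0 l1 l2 l12 : R) (hl0 : 0 < l0) (hC : l1 * l2 ≤ l0 * l12)
    (hcomp : l0 * ((((∑ W ∈ U.powerset, ν W * chainMix ent ent' 0 c d W) * (∑ W ∈ U.powerset, ν W * chainMix ent ent' 1 c d W * x W) - (∑ W ∈ U.powerset, ν W * chainMix ent ent' 0 c d W * x W) * (∑ W ∈ U.powerset, ν W * chainMix ent ent' 1 c d W)) *
          ((∑ W ∈ U.powerset, ν W * chainMix ent ent' 0 c d W) * (∑ W ∈ U.powerset, ν W * chainMix ent ent' 0 c d' W * y W) - (∑ W ∈ U.powerset, ν W * chainMix ent ent' 0 c d W * y W) * (∑ W ∈ U.powerset, ν W * chainMix ent ent' 0 c d' W))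
        + ((∑ W ∈ U.powerset, ν W * chainMix ent ent' 0 c d W) * (∑ W ∈ U.powerset, ν W * chainMix ent ent' 1 c d W * y W) - (∑ W ∈ U.powerset, ν W * chainMix ent ent' 0 c d W * y W) * (∑ W ∈ U.powerset, ν W * chainMix ent ent' 1 c d W)) *
          ((∑ W ∈ U.powerset, ν W * chainMix ent ent' 0 c d W) * (∑ W ∈ U.powerset, ν W * chainMix ent ent' 0 c d' W * x W) - (∑ W ∈ U.powerset, ν W * chainMix ent ent' 0 c d W * x W) * (∑ W ∈ U.powerset, ν W * chainMix ent ent' 0 c d' W)))) ≤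
      (∑ W ∈ U.powerset, ν W * chainMix ent ent' 0 c d W) * (((∑ W ∈ U.powerset, ν W * chainMix ent ent' 0 c d W) * l1 - (∑ W ∈ U.powerset, ν W * chainMix ent ent' 0 c d W * x W) * l0) * ((∑ W ∈ U.powerset, ν W * chainMix ent ent' 0 c d W) * l2 - (∑ W ∈ U.powerset, ν W * chainMix ent ent' 0 c d W * y W) * l0)
        - l0 * ((∑ W ∈ U.powerset, ν W * chainMix ent ent' 0 c d W) * (∑ W ∈ U.powerset, ν W * chainMix ent ent' 0 c d W) * (l12 - (∑ W ∈ U.powerset, ν W * chainMix ent ent' 1 c d' W * (x W * y W))) - (∑ W ∈ U.powerset, ν W * chainMix ent ent' 0 c d W) * (∑ W ∈ U.powerset, ν W * chainMix ent ent' 0 c d W * y W) * (l1 - (∑ W ∈ U.powerset, ν W * chainMix ent ent' 1 c d' W * x W))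
          - (∑ W ∈ U.powerset, ν W * chainMix ent ent' 0 c d W) * (∑ W ∈ U.powerset, ν W * chainMix ent ent' 0 c d W * x W) * (l2 - (∑ W ∈ U.powerset, ν W * chainMix ent ent' 1 c d' W * y W)) + (∑ W ∈ U.powerset, ν W * chainMix ent ent' 0 c d W * x W) * (∑ W ∈ U.powerset, ν W * chainMix ent ent' 0 c d W * y W) * (l0 - (∑ W ∈ U.powerset, ν W * chainMix ent ent' 1 c d' W)))))
    :
    (((∑ W ∈ U.powerset, ν W * chainMix ent ent' 0 c d W) * (∑ W ∈ U.powerset, ν W * chainMix ent ent' 1 c d W * x W) - (∑ W ∈ U.powerset, ν W * chainMix ent ent' 0 c d W * x W) * (∑ W ∈ U.powerset, ν W * chainMix ent ent' 1 c d W)) *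
          ((∑ W ∈ U.powerset, ν W * chainMix ent ent' 0 c d W) * (∑ W ∈ U.powerset, ν W * chainMix ent ent' 0 c d' W * y W) - (∑ W ∈ U.powerset, ν W * chainMix ent ent' 0 c d W * y W) * (∑ W ∈ U.powerset, ν W * chainMix ent ent' 0 c d' W))
        + ((∑ W ∈ U.powerset, ν W * chainMix ent ent' 0 c d W) * (∑ W ∈ U.powerset, ν W * chainMix ent ent' 1 c d W * y W) - (∑ W ∈ U.powerset, ν W * chainMix ent ent' 0 c d W * y W) * (∑ W ∈ U.powerset, ν W * chainMix ent ent' 1 c d W)) *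
          ((∑ W ∈ U.powerset, ν W * chainMix ent ent' 0 c d W) * (∑ W ∈ U.powerset, ν W * chainMix ent ent' 0 c d' W * x W) - (∑ W ∈ U.powerset, ν W * chainMix ent ent' 0 c d W * x W) * (∑ W ∈ U.powerset, ν W * chainMix ent ent' 0 c d' W))) ≤
        (∑ W ∈ U.powerset, ν W * chainMix ent ent' 0 c d W) * ((∑ W ∈ U.powerset, ν W * chainMix ent ent' 0 c d W) * (∑ W ∈ U.powerset, ν W * chainMix ent ent' 0 c d W) * (∑ W ∈ U.powerset, ν W * chainMix ent ent' 1 c d' W * (x W * y W))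
          - (∑ W ∈ U.powerset, ν W * chainMix ent ent' 0 c d W) * (∑ W ∈ U.powerset, ν W * chainMix ent ent' 0 c d W * y W) * (∑ W ∈ U.powerset, ν W * chainMix ent ent' 1 c d' W * x W)
          - (∑ W ∈ U.powerset, ν W * chainMix ent ent' 0 c d W) * (∑ W ∈ U.powerset, ν W * chainMix ent ent' 0 c d W * x W) * (∑ W ∈ U.powerset, ν W * chainMix ent ent' 1 c d' W * y W)
          + (∑ W ∈ U.powerset, ν W * chainMix ent ent' 0 c d W * x W) * (∑ W ∈ U.powerset, ν W * chainMix ent ent' 0 c d W * y W) * (∑ W ∈ U.powerset, ν W * chainMix ent ent' 1 c d' W)) := by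
  have hm0 : ∀ W, 0 ≤ chainMix ent ent' 0 c d W := chainMix_nonneg ent ent' le_rfl zero_le_one hc0 hd0
  have ha0 : 0 ≤ ∑ W ∈ U.powerset, ν W * chainMix ent ent' 0 c d W :=
    Finset.sum_nonneg fun W _ => mul_nonneg (hν0 W) (hm0 W)
  exact xa_complement_alg _ _ _ _ _ _ _ _ _ _ _ _ hl0 ha0 hC hcomp

end ComplementChain

end Summit.Ventures.PercRepro2.Coin
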